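import Mathlib

/-!
# LeakDemandAnyPhase — embed g16 (MINT E4 «change the CM»): the κ-inputs of THEOREM L^ζ are phase-free

Evidence file for `stmt-HodgeConjecture-18881` (D-0145 line `Cruxes/BlochSeedDiscOne/Lines/birth.lean`,
stub `stub_rung_pad4_seedAt` untouched).  Mathlib-only, census-neutral: coordinate linear algebra in
`V_f = H^{0,1}(S_f) ≅ ℂ²`, nothing about sheaves, designs, (H1), (H2) or a SEED; nothing here is proved toward
HC ∕ HC_CM ∕ HC_AV ∕ №4 ∕ 26512 ∕ 18881 ∕ H2.

Conventions = PAD4-THEOREM-L-search-1 (6.6) with the phase `ζ ∈ μ₄` replaced by an ARBITRARY `z : ℂ`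
(its conjugate is carried as an independent parameter `zb`, so every identity below is a polynomial identity,
valid in particular for the ω-frame equator alphabet R3: units `ζ₆ʲ`, ν-rays `z₀ζ₆ʲ, z̄₀ζ₆ʲ` (`z₀ = (8+5ω)/7`),
13-rays — all with `z̄z = 1`):
* basis `(ē_A, ē_B)` of `V_f` ↦ indices `0, 1` of `Fin 2 → ℂ`;  `ξ̄_z = ē_A + z̄ ē_B` ↦ `xiBar zb = ![1, zb]`;
* a hyperbolic Weil tangent `κ ↔ k ∈ M₄(ℂ)` (`e_{A_g} ↦ Σ_j k_{jg} ē_{B_j}`, `e_{B_j} ↦ Σ_g k_{jg} ē_{A_g}`), so that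
  `κ(ξ_z^{(f)})_τ = z·k_{fτ} ē_{A_τ} + k_{τf} ē_{B_τ}` ↦ `kap k z f τ = ![z * k f τ, k τ f]`;
* `w_z(a ē_A + b ē_B) = b − z̄ a` kills `ξ̄_z` (`wfun_xiBar`), i.e. "mod Ξ_z";
* for a constituent charged `c_σ` on `(σ, z_σ)` and `c_f` on `(f, z_f)` the `V_σ ⊗ V_f` block of `(κ ∪ c₁)^{0,2}` is
  `D = c_σ ξ̄_σ ⊗ κ(ξ_σ)_f − c_f κ(ξ_f)_σ ⊗ ξ̄_f` ↦ `leakBlock`.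

Results (all `by simp; ring`-sized):
* `leak_value`     — (L1) phase-free: `D mod V_σ ⊗ Ξ_f = c_σ (k_{fσ} − z̄_f z_σ k_{σf}) · ξ̄_σ`;
* `leak_ne_zero`   — at the single tangent `k = E_{fσ}` the leak is `c_σ ξ̄_σ ≠ 0` for EVERY pair of phases (`c_σ ≠ 0`);
* `diagBlock_equator` — the `Λ²V_f` block `c_f k_{ff}(1 − z̄z)` vanishes on the equator `z̄z = 1` for every κ;
* `escape_ne_zero` — (C′-escape at `Q̃ = h e_f`, third factor τ): `h ξ̄_f ⊗ κ(ξ_f)_τ ≠ 0` at `k = E_{τf}`, any phase;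
* `sweep`          — for `z ≠ 0`, `κ ↦ κ(ξ_z^{(f)})_τ` is onto `V_τ` (`f ≠ τ`);  `sweep_fails_polar` — not for `z = 0`.
So REMARK G of PAD4-THEOREM-L (6.8δ) («nothing uses ζ ∈ μ₄ beyond indexing») holds for every NON-POLAR ray,
in particular for the whole ω-frame alphabet R3; see the memo ONE-HUB-LINE28-embed-g16.md §4.
-/

set_option linter.dupNamespace false

namespace Summit.HodgeConjecture.HodgeConjecture.Cruxes.BlochSeedDiscOne.EmbedG16

/-- `ξ̄_z = ē_A + z̄ ē_B` in coordinates; `zb` stands for `z̄`. -/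
def xiBar (zb : ℂ) : Fin 2 → ℂ := ![1, zb]

/-- `κ(ξ_z^{(f)})_τ = z k_{fτ} ē_{A_τ} + k_{τf} ē_{B_τ}` for `κ ↔ k`. -/
def kap (k : Matrix (Fin 4) (Fin 4) ℂ) (z : ℂ) (f τ : Fin 4) : Fin 2 → ℂ := ![z * k f τ, k τ f]

/-- the elementary tangent `E_{ij}` (`k_{ij} = 1`, all other entries `0`). -/
def kE (i j : Fin 4) : Matrix (Fin 4) (Fin 4) ℂ := fun a b => if a = i ∧ b = j then 1 else 0

/-- `w_z : V → ℂ`, `a ē_A + b ē_B ↦ b − z̄ a`. -/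
def wfun (zb : ℂ) (v : Fin 2 → ℂ) : ℂ := v 1 - zb * v 0

/-- `u ⊗ v` as a `2 × 2` array. -/
def tens (u v : Fin 2 → ℂ) : Fin 2 → Fin 2 → ℂ := fun a b => u a * v b

/-- contract the SECOND tensor factor with `w_z` ("mod V ⊗ Ξ_z"). -/
def contrR (zb : ℂ) (M : Fin 2 → Fin 2 → ℂ) : Fin 2 → ℂ := fun a => M a 1 - zb * M a 0

/-- the `V_σ ⊗ V_f` block `D = c_σ ξ̄_σ ⊗ κ(ξ_σ)_f − c_f κ(ξ_f)_σ ⊗ ξ̄_f` of `(κ ∪ c₁ X)^{0,2}`. -/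
def leakBlock (k : Matrix (Fin 4) (Fin 4) ℂ) (cσ cf zσ zbσ zf zbf : ℂ) (σ f : Fin 4) :
    Fin 2 → Fin 2 → ℂ :=
  fun a b => cσ * tens (xiBar zbσ) (kap k zσ σ f) a b - cf * tens (kap k zf f σ) (xiBar zbf) a b

/-- the `Λ² V_f` block: coefficient of `ē_A ∧ ē_B` in `c_f ξ̄_f ∧ κ(ξ_f)_f`. -/
def diagBlock (k : Matrix (Fin 4) (Fin 4) ℂ) (cf zf zbf : ℂ) (f : Fin 4) : ℂ :=
  cf * (xiBar zbf 0 * kap k zf f f 1 - xiBar zbf 1 * kap k zf f f 0)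

/-- the `V_f ⊗ V_τ` block `h ξ̄_f ⊗ κ(ξ_f)_τ` of the demand of the axis constituent `Q̃ = h e_f` (τ a third factor). -/
def escapeBlock (k : Matrix (Fin 4) (Fin 4) ℂ) (h zf zbf : ℂ) (f τ : Fin 4) : Fin 2 → Fin 2 → ℂ :=
  fun a b => h * tens (xiBar zbf) (kap k zf f τ) a b

theorem wfun_xiBar (zb : ℂ) : wfun zb (xiBar zb) = 0 := by
  simp [wfun, xiBar]

/-- **(L1) phase-free.** `D mod V_σ ⊗ Ξ_f = c_σ (k_{fσ} − z̄_f z_σ k_{σf}) · ξ̄_σ` for every `k, z_σ, z_f`. -/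
theorem leak_value (k : Matrix (Fin 4) (Fin 4) ℂ) (cσ cf zσ zbσ zf zbf : ℂ) (σ f : Fin 4) :
    contrR zbf (leakBlock k cσ cf zσ zbσ zf zbf σ f) =
      fun a => cσ * (k f σ - zbf * zσ * k σ f) * xiBar zbσ a := by
  funext a
  fin_cases a <;> simp [contrR, leakBlock, tens, xiBar, kap] <;> ring

/-- at the elementary tangent `E_{fσ}` the leak is `c_σ ξ̄_σ`, whatever the two phases. -/
theorem leak_at_E (cσ cf zσ zbσ zf zbf : ℂ) (σ f : Fin 4) (hσf : σ ≠ f) :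
    contrR zbf (leakBlock (kE f σ) cσ cf zσ zbσ zf zbf σ f) = fun a => cσ * xiBar zbσ a := by
  rw [leak_value]
  funext a
  simp [kE, hσf]

/-- **(L1) holds in every frame:** the leak demand is non-zero mod `V_σ ⊗ Ξ_f` for some hyperbolic Weil tangent
(namely `E_{fσ}`), for EVERY pair of phases `z_σ, z_f` and every charge `c_σ ≠ 0`. -/
theorem leak_ne_zero (cσ cf zσ zbσ zf zbf : ℂ) (σ f : Fin 4) (hσf : σ ≠ f) (hc : cσ ≠ 0) :
    contrR zbf (leakBlock (kE f σ) cσ cf zσ zbσ zf zbf σ f) ≠ 0 := by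
  rw [leak_at_E _ _ _ _ _ _ _ _ hσf]
  intro h
  have h0 := congrFun h 0
  simp [xiBar] at h0
  exact hc h0

/-- the `Λ²V_f` block equals `c_f k_{ff} (1 − z̄_f z_f)`. -/
theorem diagBlock_eq (k : Matrix (Fin 4) (Fin 4) ℂ) (cf zf zbf : ℂ) (f : Fin 4) :
    diagBlock k cf zf zbf f = cf * k f f * (1 - zbf * zf) := by
  simp [diagBlock, xiBar, kap]
  ring

/-- … hence vanishes for EVERY κ on the equator `z̄ z = 1` (units, ν-rays, 13-rays of R3; the μ₄ letters). -/
theorem diagBlock_equator (k : Matrix (Fin 4) (Fin 4) ℂ) (cf zf zbf : ℂ) (f : Fin 4) (h : zbf * zf = 1) :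
    diagBlock k cf zf zbf f = 0 := by
  rw [diagBlock_eq, h]
  ring

/-- **(C′-escape) phase-free:** at `k = E_{τf}` the block `h ξ̄_f ⊗ κ(ξ_f)_τ` is `h ξ̄_f ⊗ ē_B`. -/
theorem escape_at_E (h zf zbf : ℂ) (f τ : Fin 4) (hfτ : f ≠ τ) :
    escapeBlock (kE τ f) h zf zbf f τ = fun a b => h * (xiBar zbf a * (![0, 1] : Fin 2 → ℂ) b) := by
  funext a b
  fin_cases b <;> simp [escapeBlock, tens, kap, kE, hfτ]

/-- … and is non-zero for `h ≠ 0`, whatever the phase `z_f`. -/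
theorem escape_ne_zero (h zf zbf : ℂ) (f τ : Fin 4) (hfτ : f ≠ τ) (hh : h ≠ 0) :
    escapeBlock (kE τ f) h zf zbf f τ ≠ 0 := by
  rw [escape_at_E _ _ _ _ _ hfτ]
  intro H
  have h01 := congrFun (congrFun H 0) 1
  simp [xiBar] at h01
  exact hh h01

/-- **SWEEP** (PAD4-THEOREM-L (6.6), phase-free): for a NON-POLAR direction `z ≠ 0` and `f ≠ τ`,
`κ ↦ κ(ξ_z^{(f)})_τ` is onto `V_τ`. -/
theorem sweep (z : ℂ) (hz : z ≠ 0) (f τ : Fin 4) (hfτ : f ≠ τ) (v : Fin 2 → ℂ) :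
    ∃ k : Matrix (Fin 4) (Fin 4) ℂ, kap k z f τ = v := by
  refine ⟨fun a b => if a = f ∧ b = τ then v 0 / z else if a = τ ∧ b = f then v 1 else 0, ?_⟩
  funext a
  fin_cases a
  · simp [kap]
    field_simp
  · simp [kap, hfτ, Ne.symm hfτ]

/-- … whereas for the POLAR direction `z = 0` (`ξ = e_A`, letters `[E × 0]`) the `ē_A`-coordinate of
`κ(ξ^{(f)})_τ` vanishes for every κ: the sweep fails, and the transplant is stated for non-polar rays only. -/
theorem sweep_fails_polar (k : Matrix (Fin 4) (Fin 4) ℂ) (f τ : Fin 4) : kap k 0 f τ 0 = 0 := by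
  simp [kap]

end Summit.HodgeConjecture.HodgeConjecture.Cruxes.BlochSeedDiscOne.EmbedG16
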